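import Mathlib
import HarnessLib
import Literature.Analysis.Approximation.TuranFormEstimates

/-!
# `stub_mnTuran` — registered stub of line `FilterInvariance`
# (card `band-limited-krylov-dimerisation`), crux `EmbeddedDrudeMourre.GreenKuboContinuation`
# (item stmt-AtomisticToContinuum-12597)

Target `Summits/AtomisticToContinuum/FouriersLaw/Theorems/EmbeddedDrudeMourreGreenKuboContinuationMnTuran.lean`
(`ledger propose --supports stmt-AtomisticToContinuum-12597`). The theorem name and signature of
`stub_mnTuran` are REGISTERED and stay verbatim.

## Content (the Turán-determinant limit under bounded variation; no measure appears)

Let `A n > 0`, `A n → 1/2`, `Σ |A (n+1) - A n| < ∞`, and let polynomials `p n` satisfy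
`X p (n+1) = A (n+1) p (n+2) + A n p n` with `p 0` a non-zero constant. The Turán quadratic forms
`S_n(x) = p_{n+1}(x)² - (x / A_n) p_{n+1}(x) p_n(x) + p_n(x)²` converge uniformly on every
`[-1+δ, 1-δ]`, `δ > 0`, to one function `S : ℝ → ℝ` (here `S x := lim_n S_n(x)`), continuous and
strictly positive on `(-1, 1)` (Máté–Nevai 1983; Dombrowski–Nevai 1986, Thm 1).

## Proof (elementary; the analysis lemmas are `Literature.Analysis.Approximation.TuranForm.*`)

On the band `K = [-1+δ, 1-δ]` (`0 < δ ≤ 1`), eventually `A n ≥ a := (2-δ)/4`, so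
`|x| / A_n ≤ 2ρ` with `ρ := (1-δ)/(2a) < 1` and `S_n ≥ (1-ρ)(p_{n+1}² + p_n²) ≥ 0` (ellipticity).
Evaluating the recurrence, `S_{n+1} - S_n = p_{n+2} p_n (A_{n+1} - A_n)(1/A_n + 1/A_{n+1})`, whence
`|S_{n+1} - S_n| ≤ ε_n (S_{n+1} + S_n)` with `ε_n = |A_{n+1} - A_n| / ((1-ρ) a)` summable. For
`ε_n ≤ 1/2` this gives `S_{n+1} ≤ (1 + 4ε_n) S_n` and `S_n ≤ (1 + 4ε_n) S_{n+1}`, so (discrete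
Grönwall) `e^{-E} S_N ≤ S_n ≤ e^{E} S_N` on `K` for `n ≥ N`, `E = 4 Σ ε_n`. `S_N` is continuous,
hence bounded on `K`, so the increments are uniformly summable: `S_n` converges uniformly on `K`.
`S_N > 0` on `K` because two consecutive `p_n` never vanish together (`p_0 ≠ 0`), so the limit is
`≥ e^{-E} S_N(x) > 0`; continuity on `(-1, 1)` follows from local uniform convergence. The initial
relation `X p 0 = A 0 p 1` is part of the registered signature but is not used.
-/

noncomputable section

namespace Summit.AtomisticToContinuum.FouriersLaw.Theorems.GreenKuboContinuation.BandLimitedKrylov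

open Filter Topology MeasureTheory Set Polynomial
open Literature.Analysis.Approximation

namespace MnTuran

/-- **Core estimate for `stub_mnTuran` on a band `[-1+δ, 1-δ]`, `0 < δ ≤ 1`.** Along the
recurrence `x p_{n+1} = A_{n+1} p_{n+2} + A_n p_n` with `A_n > 0`, `A_n → 1/2`,
`Σ|A_{n+1} - A_n| < ∞` and `p_0` a non-zero constant, the Turán forms
`F n x = p_{n+1}² - (x/A_n) p_{n+1} p_n + p_n²`
have, from some index `N` on and uniformly on the band, summable increments
`|F (n+1) x - F n x| ≤ η n`, a uniform relative lower bound `c · F N x ≤ F n x` (`c > 0`), and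
`F N > 0` on the band (ellipticity + one-step identity + discrete Grönwall; consecutive `p_n` have
no common zero). (Máté–Nevai 1983; Dombrowski–Nevai 1986, Thm 1.) [folklore] -/
theorem mnTuran_core (A : ℕ → ℝ) (p : ℕ → ℝ[X]) (hA : ∀ n, 0 < A n)
    (hAlim : Tendsto A atTop (𝓝 (1 / 2))) (hAbv : Summable (fun n => |A (n + 1) - A n|))
    (hp0deg : (p 0).natDegree = 0) (hp0 : p 0 ≠ 0)
    (hrec : ∀ n, X * p (n + 1) = C (A (n + 1)) * p (n + 2) + C (A n) * p n)
    {δ : ℝ} (hδ : 0 < δ) (hδ1 : δ ≤ 1) (F : ℕ → ℝ → ℝ)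
    (hF : ∀ n x, F n x = ((p (n + 1)).eval x) ^ 2
      - x / A n * (p (n + 1)).eval x * (p n).eval x + ((p n).eval x) ^ 2) :
    ∃ (N : ℕ) (η : ℕ → ℝ) (c : ℝ), Summable η ∧ 0 < c ∧
      (∀ n, N ≤ n → ∀ x ∈ Set.Icc (-1 + δ) (1 - δ), dist (F n x) (F (n + 1) x) ≤ η n) ∧
      (∀ n, N ≤ n → ∀ x ∈ Set.Icc (-1 + δ) (1 - δ), c * F N x ≤ F n x) ∧
      (∀ x ∈ Set.Icc (-1 + δ) (1 - δ), 0 < F N x) := by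
  -- the constants `a` (eventual lower bound of `A`) and `ρ < 1` (ellipticity defect)
  set a : ℝ := (2 - δ) / 4 with ha_def
  have ha0 : 0 < a := by rw [ha_def]; linarith
  have ha2 : a < 1 / 2 := by rw [ha_def]; linarith
  set ρ : ℝ := (1 - δ) / (2 * a) with hρ_def
  have hρ0 : 0 ≤ ρ := div_nonneg (by linarith) (by positivity)
  have hρ1 : ρ < 1 := by
    rw [hρ_def, div_lt_one (by positivity : (0 : ℝ) < 2 * a), ha_def]
    linarith
  have h2ρa : 2 * ρ * a = 1 - δ := by
    rw [hρ_def]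
    field_simp
  have h1ρ : 0 < 1 - ρ := by linarith
  -- eventual lower bound on `A`
  obtain ⟨N₀, hN₀⟩ : ∃ N₀, ∀ n, N₀ ≤ n → a ≤ A n :=
    eventually_atTop.1 (hAlim.eventually (eventually_ge_nhds ha2))
  -- `|x / A n| ≤ 2ρ` on the band for `n ≥ N₀`
  have hxA : ∀ n, N₀ ≤ n → ∀ x ∈ Set.Icc (-1 + δ) (1 - δ), |x / A n| ≤ 2 * ρ := by
    intro n hn x hx
    rw [abs_div, abs_of_pos (hA n), div_le_iff₀ (hA n)]
    calc |x| ≤ 1 - δ := abs_le.2 ⟨by linarith [hx.1], hx.2⟩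
      _ = 2 * ρ * a := h2ρa.symm
      _ ≤ 2 * ρ * A n := mul_le_mul_of_nonneg_left (hN₀ n hn) (by positivity)
  -- the evaluated recurrence, and `p 0` does not vanish
  have hev : ∀ n x, x * (p (n + 1)).eval x
      = A (n + 1) * (p (n + 2)).eval x + A n * (p n).eval x := by
    intro n x
    have := congrArg (Polynomial.eval x) (hrec n)
    simpa only [eval_mul, eval_X, eval_C, eval_add] using this
  have hu0 : ∀ x, (p 0).eval x ≠ 0 := by
    intro x h0
    rw [eq_C_of_natDegree_eq_zero hp0deg, eval_C] at h0
    apply hp0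
    rw [eq_C_of_natDegree_eq_zero hp0deg, h0, C_0]
  -- ellipticity on the band for `n ≥ N₀`
  have hell : ∀ n, N₀ ≤ n → ∀ x ∈ Set.Icc (-1 + δ) (1 - δ),
      (1 - ρ) * (((p (n + 1)).eval x) ^ 2 + ((p n).eval x) ^ 2) ≤ F n x := by
    intro n hn x hx
    rw [hF]
    exact TuranForm.quadForm_lower (hxA n hn x hx)
  have hFnn : ∀ n, N₀ ≤ n → ∀ x ∈ Set.Icc (-1 + δ) (1 - δ), 0 ≤ F n x := fun n hn x hx =>
    (mul_nonneg h1ρ.le (by positivity)).trans (hell n hn x hx)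
  -- the summable sequence `ε n = |A (n+1) - A n| / ((1 - ρ) a)`
  set ε : ℕ → ℝ := fun n => |A (n + 1) - A n| / ((1 - ρ) * a) with hε_def
  have h1ρa : 0 < (1 - ρ) * a := mul_pos h1ρ ha0
  have hε0 : ∀ n, 0 ≤ ε n := fun n => div_nonneg (abs_nonneg _) h1ρa.le
  have hεs : Summable ε := hAbv.div_const _
  -- the one-step inequality on the band for `n ≥ N₀`
  have hstep : ∀ n, N₀ ≤ n → ∀ x ∈ Set.Icc (-1 + δ) (1 - δ),
      |F (n + 1) x - F n x| ≤ ε n * (F (n + 1) x + F n x) := by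
    intro n hn x hx
    have hn1 : N₀ ≤ n + 1 := Nat.le_succ_of_le hn
    have key := TuranForm.step_abs_le ha0 (hN₀ n hn) (hN₀ (n + 1) hn1) hρ1.le
      (hxA n hn x hx) (hxA (n + 1) hn1 x hx) (hev n x) (hF n x) (hF (n + 1) x)
    show |F (n + 1) x - F n x| ≤ |A (n + 1) - A n| / ((1 - ρ) * a) * (F (n + 1) x + F n x)
    rw [div_mul_eq_mul_div, le_div_iff₀ h1ρa]
    exact key
  -- `N₁ ≥ N₀` with `ε n ≤ 1/2` beyond
  obtain ⟨N₁, hN₁0, hN₁⟩ : ∃ N₁, N₀ ≤ N₁ ∧ ∀ n, N₁ ≤ n → ε n ≤ 1 / 2 := by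
    have h1 : ∀ᶠ n in atTop, ε n ≤ 1 / 2 :=
      hεs.tendsto_atTop_zero.eventually (eventually_le_nhds (by norm_num : (0 : ℝ) < 1 / 2))
    obtain ⟨N₁, hN₁⟩ := eventually_atTop.1 (h1.and (eventually_ge_atTop N₀))
    exact ⟨N₁, (hN₁ N₁ le_rfl).2, fun n hn => (hN₁ n hn).1⟩
  -- two-sided Grönwall control from level `N₁` on
  set E : ℝ := ∑' k, 4 * ε k with hE_def
  have hG : ∀ x ∈ Set.Icc (-1 + δ) (1 - δ), ∀ n, N₁ ≤ n →
      F n x ≤ Real.exp E * F N₁ x ∧ F N₁ x ≤ Real.exp E * F n x := by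
    intro x hx
    refine TuranForm.two_sided_gronwall (fun n => F n x) (fun n => 4 * ε n) N₁
      (fun n => mul_nonneg (by norm_num) (hε0 n)) (hεs.mul_left 4)
      (fun n hn => hFnn n (hN₁0.trans hn) x hx) ?_ ?_
    · intro n hn
      have hn0 : N₀ ≤ n := hN₁0.trans hn
      exact (TuranForm.ratio_bounds_of_abs_sub_le (hFnn n hn0 x hx)
        (hFnn (n + 1) (Nat.le_succ_of_le hn0) x hx) (hε0 n) (hN₁ n hn) (hstep n hn0 x hx)).1
    · intro n hn
      have hn0 : N₀ ≤ n := hN₁0.trans hn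
      exact (TuranForm.ratio_bounds_of_abs_sub_le (hFnn n hn0 x hx)
        (hFnn (n + 1) (Nat.le_succ_of_le hn0) x hx) (hε0 n) (hN₁ n hn) (hstep n hn0 x hx)).2
  -- a bound for `F N₁` on the (compact) band
  have hcont : Continuous (F N₁) := by
    rw [funext (hF N₁)]
    fun_prop
  obtain ⟨M, hM⟩ := isCompact_Icc.exists_bound_of_continuousOn hcont.continuousOn
  have hM' : ∀ x ∈ Set.Icc (-1 + δ) (1 - δ), F N₁ x ≤ max M 0 := by
    intro x hx
    have := hM x hx
    rw [Real.norm_eq_abs] at this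
    exact ((le_abs_self _).trans this).trans (le_max_left _ _)
  have hB : ∀ x ∈ Set.Icc (-1 + δ) (1 - δ), ∀ n, N₁ ≤ n → F n x ≤ Real.exp E * max M 0 :=
    fun x hx n hn => (hG x hx n hn).1.trans
      (mul_le_mul_of_nonneg_left (hM' x hx) (Real.exp_pos _).le)
  refine ⟨N₁, fun n => ε n * (2 * (Real.exp E * max M 0)), Real.exp (-E), hεs.mul_right _,
    Real.exp_pos _, ?_, ?_, ?_⟩
  · intro n hn x hx
    rw [Real.dist_eq, abs_sub_comm]
    refine (hstep n (hN₁0.trans hn) x hx).trans (mul_le_mul_of_nonneg_left ?_ (hε0 n))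
    have b1 := hB x hx (n + 1) (Nat.le_succ_of_le hn)
    have b0 := hB x hx n hn
    linarith
  · intro n hn x hx
    rw [Real.exp_neg, inv_mul_le_iff₀ (Real.exp_pos _)]
    exact (hG x hx n hn).2
  · intro x hx
    have hsq := TuranForm.sq_add_sq_pos_of_recurrence (fun k => (p k).eval x) A x
      (fun n => (hA n).ne') (hu0 x) (fun n => hev n x) N₁
    exact lt_of_lt_of_le (mul_pos h1ρ hsq) (hell N₁ hN₁0 x hx)

end MnTuran

open MnTuran in
/-- **`stub_mnTuran` — the Turán-determinant limit under bounded variation** (Máté–Nevai 1983;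
Dombrowski–Nevai 1986, Thm 1, in the quadratic-form normalisation). Let `A n > 0`, `A n → 1/2`,
`Σ |A (n+1) - A n| < ∞`, and let the polynomials `p_n` satisfy `x p_0 = A_0 p_1`,
`x p_{n+1} = A_{n+1} p_{n+2} + A_n p_n` with `p_0` a non-zero constant. Then the Turán forms
`S_n(x) = p_{n+1}(x)² - (x / A_n) p_{n+1}(x) p_n(x) + p_n(x)²` converge uniformly on every
`[-1+δ, 1-δ]` (`δ > 0`) to one function `S`, continuous and strictly positive on `(-1, 1)`.
Proof: ellipticity `S_n ≥ (1 - ρ)(p_{n+1}² + p_n²)` on the band, the one-step identity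
`S_{n+1} - S_n = p_{n+2} p_n (A_{n+1} - A_n)(1/A_n + 1/A_{n+1})`, hence
`|S_{n+1} - S_n| ≤ ε_n (S_{n+1} + S_n)` with `Σ ε_n < ∞`; a two-sided discrete Grönwall lemma gives
uniform bounds, hence uniformly summable increments; consecutive `p_n` have no common zero since
`p_0 ≠ 0`. (The initial relation `x p_0 = A_0 p_1` is not needed.)
[cite: DombrowskiNevai1986, Thm 1] -/
theorem stub_mnTuran :
    ∀ (A : ℕ → ℝ) (p : ℕ → ℝ[X]),
      (∀ n, 0 < A n) → Tendsto A atTop (𝓝 (1 / 2)) → Summable (fun n => |A (n + 1) - A n|) →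
      (p 0).natDegree = 0 → p 0 ≠ 0 →
      X * p 0 = C (A 0) * p 1 →
      (∀ n, X * p (n + 1) = C (A (n + 1)) * p (n + 2) + C (A n) * p n) →
      ∃ S : ℝ → ℝ, ContinuousOn S (Set.Ioo (-1) 1) ∧ (∀ x ∈ Set.Ioo (-1 : ℝ) 1, 0 < S x) ∧
        ∀ δ : ℝ, 0 < δ →
          TendstoUniformlyOn
            (fun (n : ℕ) (x : ℝ) => ((p (n + 1)).eval x) ^ 2
              - x / A n * (p (n + 1)).eval x * (p n).eval x + ((p n).eval x) ^ 2)
            S atTop (Set.Icc (-1 + δ) (1 - δ)) := by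
  intro A p hA hAlim hAbv hp0deg hp0 _hrec0 hrec
  set F : ℕ → ℝ → ℝ := fun n x => ((p (n + 1)).eval x) ^ 2
      - x / A n * (p (n + 1)).eval x * (p n).eval x + ((p n).eval x) ^ 2 with hF_def
  have hF : ∀ n x, F n x = ((p (n + 1)).eval x) ^ 2
      - x / A n * (p (n + 1)).eval x * (p n).eval x + ((p n).eval x) ^ 2 := fun n x => rfl
  set S : ℝ → ℝ := fun x => limUnder atTop (fun n => F n x) with hS_def
  -- uniform convergence on every band
  have hunif1 : ∀ δ : ℝ, 0 < δ → δ ≤ 1 →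
      TendstoUniformlyOn F S atTop (Set.Icc (-1 + δ) (1 - δ)) := by
    intro δ hδ hδ1
    obtain ⟨N, η, c, hη, -, hinc, -, -⟩ :=
      mnTuran_core A p hA hAlim hAbv hp0deg hp0 hrec hδ hδ1 F hF
    exact TuranForm.tendstoUniformlyOn_limUnder_of_dist_succ_le F _ η N hη hinc
  have hunif : ∀ δ : ℝ, 0 < δ → TendstoUniformlyOn F S atTop (Set.Icc (-1 + δ) (1 - δ)) := by
    intro δ hδ
    refine (hunif1 (min δ 1) (lt_min hδ one_pos) (min_le_right _ _)).mono ?_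
    exact Set.Icc_subset_Icc (by linarith [min_le_left δ 1]) (by linarith [min_le_left δ 1])
  have hFcont : ∀ n, Continuous (F n) := fun n => by
    rw [funext (hF n)]
    fun_prop
  refine ⟨S, TuranForm.continuousOn_Ioo_of_tendstoUniformlyOn_Icc F S hFcont hunif, ?_, hunif⟩
  -- strict positivity on `(-1, 1)`
  intro x hx
  set δ : ℝ := min (x + 1) (1 - x) / 2 with hδ_def
  have hx1 : 0 < x + 1 := by linarith [hx.1]
  have hx2 : 0 < 1 - x := by linarith [hx.2]
  have hδ : 0 < δ := by positivity
  have hδ1 : δ ≤ 1 := by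
    have := min_le_left (x + 1) (1 - x)
    have := min_le_right (x + 1) (1 - x)
    rw [hδ_def]
    linarith
  have hxK : x ∈ Set.Icc (-1 + δ) (1 - δ) := by
    have := min_le_left (x + 1) (1 - x)
    have := min_le_right (x + 1) (1 - x)
    constructor <;> linarith
  obtain ⟨N, η, c, -, hc, -, hlow, hpos⟩ :=
    mnTuran_core A p hA hAlim hAbv hp0deg hp0 hrec hδ hδ1 F hF
  have hlim : Tendsto (fun n => F n x) atTop (𝓝 (S x)) := (hunif δ hδ).tendsto_at hxK
  have hevn : ∀ᶠ n in atTop, c * F N x ≤ F n x :=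
    eventually_atTop.2 ⟨N, fun n hn => hlow n hn x hxK⟩
  exact lt_of_lt_of_le (mul_pos hc (hpos x hxK)) (ge_of_tendsto hlim hevn)

end Summit.AtomisticToContinuum.FouriersLaw.Theorems.GreenKuboContinuation.BandLimitedKrylov

end
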